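import Summits.NavierStokesRegularity.NavierStokesRegularity.Theorems.AxisTwistDoorAveragedConeLiouvilleNUWeakEnergyInequality
import Summits.NavierStokesRegularity.NavierStokesRegularity.Theorems.AxisTwistDoorAveragedConeLiouvilleNUWeakEnergySlab
import HarnessLib

/-!
# N4 / T1 piece W1, brick B4 (W1b): the energy inequality of a Lipschitz generalized supersolution
# tested with the slab weight `η·χ_h` — Steklov form of the time-boundary terms

Route `AxisTwistDoor`, crux `AveragedConeLiouville` (stmt-NavierStokesRegularity-26889), INPUT N4 / T1,
programme `kits/N4-T1-skeleton.lean` (118454bf17607d1e), `kits/N4-T1-plan.md` v2 §7 brick (B4).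
W1a (`nu_weakEnergy_timeWeighted`, p638460) with the time weight `c = η·χ` of brick B1
(`exists_slab_cutoff`, `exists_lipschitzWith_slab_weight`, `deriv_slab_weight_ae`): the term
`∫ c′H(V)Θ²` splits into `∫ η′χH(V)Θ² + h⁻¹∫_{]t₁−h,t₁[×B} ηH(V)Θ² − h⁻¹∫_{]t₂,t₂+h[×B} ηH(V)Θ²`
(`nu_weakEnergy_slab`); `integrableOn_H_comp_mul` is the integrability of `H(V)Θ²` on the cylinder.
Brick B5 lets `h → 0⁺`.

WHAT THIS IS NOT: not a statement about Navier–Stokes; T1 is an INPUT; item 26889 and the summit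
stay open. [cite: NazarovUraltseva2011HarnackDivFree, §1 p. 2–3, §3 (3.2) (arXiv:1011.1888 p. 8)]
-/

noncomputable section

-- the summit and its single sub-problem share the name (CONVENTIONS §1)
set_option linter.dupNamespace false

open MeasureTheory Set Function Filter Topology Metric
open scoped NNReal ENNReal InnerProductSpace RealInnerProductSpace

namespace Summit.NavierStokesRegularity.NavierStokesRegularity.Theorems.AveragedConeLiouville.NUPositivity

/-- **`H(V)Θ²` is integrable on the cylinder** for `V` Lipschitz there, `H`, `Θ` continuous.
[folklore] -/
theorem integrableOn_H_comp_mul {T : ℝ} {V : ℝ → EuclideanSpace ℝ (Fin 3) → ℝ}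
    (hVlip : ∃ L, LipschitzOnWith L (uncurry V) (Ioo 0 T ×ˢ ball (0 : EuclideanSpace ℝ (Fin 3)) 1))
    {H : ℝ → ℝ} (hH : Continuous H) {Θ : EuclideanSpace ℝ (Fin 3) → ℝ} (hΘ : Continuous Θ) :
    IntegrableOn (fun p : ℝ × EuclideanSpace ℝ (Fin 3) => H (V p.1 p.2) * Θ p.2 ^ 2)
      (Ioo 0 T ×ˢ ball (0 : EuclideanSpace ℝ (Fin 3)) 1) volume := by
  set W : Set (ℝ × EuclideanSpace ℝ (Fin 3)) := Ioo 0 T ×ˢ ball (0 : EuclideanSpace ℝ (Fin 3)) 1 with hW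
  have hWm : MeasurableSet W := (isOpen_Ioo.prod isOpen_ball).measurableSet
  have hWc : IsCompact (Icc 0 T ×ˢ closedBall (0 : EuclideanSpace ℝ (Fin 3)) 1) :=
    isCompact_Icc.prod (isCompact_closedBall _ _)
  have hWsub : W ⊆ Icc 0 T ×ˢ closedBall (0 : EuclideanSpace ℝ (Fin 3)) 1 :=
    Set.prod_mono Ioo_subset_Icc_self ball_subset_closedBall
  have hWfin : volume W < ∞ := (measure_mono hWsub).trans_lt hWc.measure_lt_top
  obtain ⟨L, hL⟩ := hVlip
  obtain ⟨g, hg, hVg⟩ := hL.extend_real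
  obtain ⟨Mg, hMg⟩ := hWc.exists_bound_of_continuousOn hg.continuous.continuousOn
  obtain ⟨MH, hMH⟩ := isCompact_Icc.exists_bound_of_continuousOn (hH.continuousOn (s := Icc (-Mg) Mg))
  obtain ⟨BΘ, hBΘ⟩ := (isCompact_closedBall (0 : EuclideanSpace ℝ (Fin 3)) 1).exists_bound_of_continuousOn
    ((hΘ.pow 2).continuousOn)
  have hVc : ContinuousOn (fun p : ℝ × EuclideanSpace ℝ (Fin 3) => V p.1 p.2) W := hL.continuousOn
  have hmeas : AEStronglyMeasurable (fun p : ℝ × EuclideanSpace ℝ (Fin 3) => H (V p.1 p.2) * Θ p.2 ^ 2)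
      (volume.restrict W) :=
    ((hH.comp_continuousOn hVc).mul ((hΘ.pow 2).comp_continuousOn continuousOn_snd)).aestronglyMeasurable
      hWm
  refine Integrable.mono' (integrableOn_const hWfin.ne (C := MH * BΘ)) hmeas ?_
  filter_upwards [ae_restrict_mem hWm] with p hp
  have hVgp : V p.1 p.2 = g p := by have := hVg hp; simpa [uncurry] using this
  have hgI : g p ∈ Icc (-Mg) Mg := abs_le.mp ((Real.norm_eq_abs _).symm.le.trans (hMg p (hWsub hp)))
  rw [norm_mul, hVgp]
  exact mul_le_mul (hMH _ hgI) (hBΘ p.2 (ball_subset_closedBall hp.2)) (norm_nonneg _)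
    ((norm_nonneg _).trans (hMH _ hgI))

/-- **W1b: the energy inequality tested with the slab weight `η·χ_h` (Steklov form).** For the weak
data of W1a, `η ∈ C¹`, `η ≥ 0`, `0 < h`, `0 < t₁ − h`, `t₁ ≤ t₂`, `t₂ + h < T`, and any Lipschitz
plateau `χ` with values in `[0,1]`, `χ = 0` off `]t₁−h, t₂+h[`, derivative
`h⁻¹𝟙_{]t₁−h,t₁[} − h⁻¹𝟙_{]t₂,t₂+h[}` off the kinks (brick B1).
[cite: NazarovUraltseva2011HarnackDivFree, §1 p. 2–3, §3 (3.2) (arXiv:1011.1888 p. 8)] -/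
theorem nu_weakEnergy_slab {T : ℝ} {V : ℝ → EuclideanSpace ℝ (Fin 3) → ℝ}
    {b : ℝ → EuclideanSpace ℝ (Fin 3) → EuclideanSpace ℝ (Fin 3)}
    (hbm : Measurable (uncurry b))
    (hbΛ : ∃ Λ : ℝ, ∀ t ∈ Ioo 0 T, ∀ x ∈ ball (0 : EuclideanSpace ℝ (Fin 3)) 1, ‖b t x‖ ≤ Λ)
    (hVlip : ∃ L, LipschitzOnWith L (uncurry V) (Ioo 0 T ×ˢ ball (0 : EuclideanSpace ℝ (Fin 3)) 1))
    (hweak : ∀ η : ℝ → EuclideanSpace ℝ (Fin 3) → ℝ, (∃ K, LipschitzWith K (uncurry η)) →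
        (∀ t x, 0 ≤ η t x) →
        (∃ ρ τ : ℝ, ρ < 1 ∧ 0 < τ ∧ ∀ t x, (ρ ≤ ‖x‖ ∨ t ≤ τ) → η t x = 0) →
        0 ≤ ∫ p in Ioo 0 T ×ˢ ball (0 : EuclideanSpace ℝ (Fin 3)) 1,
          (deriv (fun s => V s p.2) p.1 * η p.1 p.2 +
            ⟪gradient (V p.1) p.2, gradient (η p.1) p.2⟫ +
            ⟪b p.1 p.2, gradient (V p.1) p.2⟫ * η p.1 p.2))
    {H : ℝ → ℝ} (hH : ContDiff ℝ 2 H) (hH' : ∀ v, deriv H v ≤ 0)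
    {Θ : EuclideanSpace ℝ (Fin 3) → ℝ} (hΘ : ContDiff ℝ 1 Θ) (hΘc : HasCompactSupport Θ) {ρ₀ : ℝ}
    (hρ₀ : ρ₀ < 1) (hΘρ : tsupport Θ ⊆ ball (0 : EuclideanSpace ℝ (Fin 3)) ρ₀)
    {η : ℝ → ℝ} (hη : ContDiff ℝ 1 η) (hη0 : ∀ t, 0 ≤ η t)
    {t₁ t₂ h : ℝ} (hh : 0 < h) (ht₁ : 0 < t₁ - h) (h12 : t₁ ≤ t₂) (ht₂ : t₂ + h < T)
    {χ : ℝ → ℝ} {Kχ : ℝ≥0} (hχ : LipschitzWith Kχ χ) (hχb : ∀ t, 0 ≤ χ t ∧ χ t ≤ 1)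
    (hχl : ∀ t, t ≤ t₁ - h → χ t = 0) (hχr : ∀ t, t₂ + h ≤ t → χ t = 0)
    (hχd : ∀ t, t ≠ t₁ - h → t ≠ t₁ → t ≠ t₂ → t ≠ t₂ + h →
      HasDerivAt χ (h⁻¹ * (Ioo (t₁ - h) t₁).indicator 1 t - h⁻¹ * (Ioo t₂ (t₂ + h)).indicator 1 t) t) :
    (∫ p in Ioo 0 T ×ˢ ball (0 : EuclideanSpace ℝ (Fin 3)) 1,
        η p.1 * χ p.1 * (deriv (deriv H) (V p.1 p.2) * ‖gradient (V p.1) p.2‖ ^ 2 * Θ p.2 ^ 2)) ≤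
      (∫ p in Ioo 0 T ×ˢ ball (0 : EuclideanSpace ℝ (Fin 3)) 1,
          deriv η p.1 * χ p.1 * (H (V p.1 p.2) * Θ p.2 ^ 2)) +
        h⁻¹ * (∫ p in Ioo (t₁ - h) t₁ ×ˢ ball (0 : EuclideanSpace ℝ (Fin 3)) 1,
          η p.1 * (H (V p.1 p.2) * Θ p.2 ^ 2)) -
        h⁻¹ * (∫ p in Ioo t₂ (t₂ + h) ×ˢ ball (0 : EuclideanSpace ℝ (Fin 3)) 1,
          η p.1 * (H (V p.1 p.2) * Θ p.2 ^ 2)) -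
        (∫ p in Ioo 0 T ×ˢ ball (0 : EuclideanSpace ℝ (Fin 3)) 1,
          η p.1 * χ p.1 * (deriv H (V p.1 p.2) *
            ⟪gradient (V p.1) p.2, gradient (fun y => Θ y ^ 2) p.2⟫)) -
        (∫ p in Ioo 0 T ×ˢ ball (0 : EuclideanSpace ℝ (Fin 3)) 1,
          η p.1 * χ p.1 * (Θ p.2 ^ 2 * (deriv H (V p.1 p.2) * ⟪b p.1 p.2, gradient (V p.1) p.2⟫))) := by
  -- W1a with the slab weight `c = η·χ`
  obtain ⟨Kc, hc⟩ := exists_lipschitzWith_slab_weight hη hχ hχb hχl hχr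
  have hc0 : ∀ t, 0 ≤ η t * χ t := fun t => mul_nonneg (hη0 t) (hχb t).1
  have hcτ : ∀ t, t ≤ t₁ - h → η t * χ t = 0 := fun t ht => by rw [hχl t ht, mul_zero]
  have hcT : ∀ t, t₂ + h ≤ t → η t * χ t = 0 := fun t ht => by rw [hχr t ht, mul_zero]
  have hA := nu_weakEnergy_timeWeighted hbm hbΛ hVlip hweak hH hH' hΘ hΘc hρ₀ hΘρ hc hc0 ht₁ ht₂ hcτ hcT
  have hG := integrableOn_H_comp_mul hVlip hH.continuous hΘ.continuous
  -- the cylinder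
  set W : Set (ℝ × EuclideanSpace ℝ (Fin 3)) := Ioo 0 T ×ˢ ball (0 : EuclideanSpace ℝ (Fin 3)) 1 with hW
  have hWm : MeasurableSet W := (isOpen_Ioo.prod isOpen_ball).measurableSet
  -- `c′ = η′χ + ηχ′` a.e. on the cylinder
  set dχ : ℝ → ℝ := fun t =>
    h⁻¹ * (Ioo (t₁ - h) t₁).indicator 1 t - h⁻¹ * (Ioo t₂ (t₂ + h)).indicator 1 t with hdχ
  have hS : ({t₁ - h, t₁, t₂, t₂ + h} : Set ℝ).Finite := by
    simp only [Set.finite_insert, Set.finite_singleton]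
  have hdae : ∀ᵐ t ∂(volume : Measure ℝ),
      deriv (fun s => η s * χ s) t = deriv η t * χ t + η t * dχ t :=
    deriv_slab_weight_ae hη hS fun t ht => by
      simp only [mem_insert_iff, mem_singleton_iff, not_or] at ht
      exact hχd t ht.1 ht.2.1 ht.2.2.1 ht.2.2.2
  have hq : Measure.QuasiMeasurePreserving (Prod.fst : ℝ × EuclideanSpace ℝ (Fin 3) → ℝ) volume volume :=
    Measure.quasiMeasurePreserving_fst
  have hdaeW : ∀ᵐ p ∂(volume.restrict W),
      deriv (fun s => η s * χ s) p.1 = deriv η p.1 * χ p.1 + η p.1 * dχ p.1 :=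
    ae_restrict_of_ae (hq.ae hdae)
  -- integrability of the split pieces (bounded factors times the integrable `H(V)Θ²`)
  obtain ⟨Cη, hCη⟩ := isCompact_Icc.exists_bound_of_continuousOn (hη.continuous.continuousOn (s := Icc 0 T))
  obtain ⟨Cη', hCη'⟩ := isCompact_Icc.exists_bound_of_continuousOn
    ((hη.continuous_deriv le_rfl).continuousOn (s := Icc 0 T))
  have hχc : Continuous χ := hχ.continuous
  have hI₁ : Integrable (fun p : ℝ × EuclideanSpace ℝ (Fin 3) =>
      deriv η p.1 * χ p.1 * (H (V p.1 p.2) * Θ p.2 ^ 2)) (volume.restrict W) := by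
    refine hG.bdd_mul (c := Cη' * 1)
      ((((hη.continuous_deriv le_rfl).comp continuous_fst).mul
        (hχc.comp continuous_fst)).aestronglyMeasurable) ?_
    filter_upwards [ae_restrict_mem hWm] with p hp
    rw [norm_mul, Real.norm_eq_abs (χ p.1), abs_of_nonneg (hχb p.1).1]
    exact mul_le_mul (hCη' p.1 (Ioo_subset_Icc_self hp.1)) (hχb p.1).2 (hχb p.1).1
      ((norm_nonneg _).trans (hCη' p.1 (Ioo_subset_Icc_self hp.1)))
  have hF : Integrable (fun p : ℝ × EuclideanSpace ℝ (Fin 3) =>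
      η p.1 * (H (V p.1 p.2) * Θ p.2 ^ 2)) (volume.restrict W) := by
    refine hG.bdd_mul (c := Cη) ((hη.continuous.comp continuous_fst).aestronglyMeasurable) ?_
    filter_upwards [ae_restrict_mem hWm] with p hp
    exact hCη p.1 (Ioo_subset_Icc_self hp.1)
  have hmI : ∀ I : Set ℝ, MeasurableSet I →
      MeasurableSet (I ×ˢ (univ : Set (EuclideanSpace ℝ (Fin 3)))) := fun I hI => hI.prod MeasurableSet.univ
  have hind : ∀ (I : Set ℝ) (p : ℝ × EuclideanSpace ℝ (Fin 3)),
      I.indicator (1 : ℝ → ℝ) p.1 * (η p.1 * (H (V p.1 p.2) * Θ p.2 ^ 2)) =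
        (I ×ˢ (univ : Set (EuclideanSpace ℝ (Fin 3)))).indicator
          (fun p => η p.1 * (H (V p.1 p.2) * Θ p.2 ^ 2)) p := by
    intro I p
    by_cases hp : p.1 ∈ I
    · rw [indicator_of_mem hp, indicator_of_mem (show p ∈ I ×ˢ univ from ⟨hp, mem_univ _⟩)]
      simp
    · rw [indicator_of_notMem hp, indicator_of_notMem (show p ∉ I ×ˢ univ from fun h' => hp h'.1)]
      simp
  have hI₂ : Integrable (fun p : ℝ × EuclideanSpace ℝ (Fin 3) =>
      η p.1 * dχ p.1 * (H (V p.1 p.2) * Θ p.2 ^ 2)) (volume.restrict W) := by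
    have e : (fun p : ℝ × EuclideanSpace ℝ (Fin 3) => η p.1 * dχ p.1 * (H (V p.1 p.2) * Θ p.2 ^ 2)) =
        fun p => h⁻¹ * (Ioo (t₁ - h) t₁ ×ˢ (univ : Set (EuclideanSpace ℝ (Fin 3)))).indicator
            (fun p => η p.1 * (H (V p.1 p.2) * Θ p.2 ^ 2)) p -
          h⁻¹ * (Ioo t₂ (t₂ + h) ×ˢ (univ : Set (EuclideanSpace ℝ (Fin 3)))).indicator
            (fun p => η p.1 * (H (V p.1 p.2) * Θ p.2 ^ 2)) p := by
      funext p
      rw [← hind, ← hind, hdχ]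
      ring
    rw [e]
    exact ((hF.indicator (hmI _ measurableSet_Ioo)).const_mul _).sub
      ((hF.indicator (hmI _ measurableSet_Ioo)).const_mul _)
  -- the slabs inside the cylinder
  have hslab : ∀ I : Set ℝ, MeasurableSet I → I ⊆ Ioo 0 T →
      ∫ p in W, (I ×ˢ (univ : Set (EuclideanSpace ℝ (Fin 3)))).indicator
          (fun p => η p.1 * (H (V p.1 p.2) * Θ p.2 ^ 2)) p =
        ∫ p in I ×ˢ ball (0 : EuclideanSpace ℝ (Fin 3)) 1, η p.1 * (H (V p.1 p.2) * Θ p.2 ^ 2) := by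
    intro I hI hIT
    rw [integral_indicator (hmI I hI), Measure.restrict_restrict (hmI I hI)]
    congr 1
    rw [hW, Set.prod_inter_prod, univ_inter, inter_eq_left.2 hIT]
  -- split `∫ c′ H(V)Θ²`
  have hD : ∫ p in W, deriv (fun s => η s * χ s) p.1 * (H (V p.1 p.2) * Θ p.2 ^ 2) =
      (∫ p in W, deriv η p.1 * χ p.1 * (H (V p.1 p.2) * Θ p.2 ^ 2)) +
        h⁻¹ * (∫ p in Ioo (t₁ - h) t₁ ×ˢ ball (0 : EuclideanSpace ℝ (Fin 3)) 1,
          η p.1 * (H (V p.1 p.2) * Θ p.2 ^ 2)) -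
        h⁻¹ * (∫ p in Ioo t₂ (t₂ + h) ×ˢ ball (0 : EuclideanSpace ℝ (Fin 3)) 1,
          η p.1 * (H (V p.1 p.2) * Θ p.2 ^ 2)) := by
    have h1 : ∫ p in W, deriv (fun s => η s * χ s) p.1 * (H (V p.1 p.2) * Θ p.2 ^ 2) =
        ∫ p in W, (deriv η p.1 * χ p.1 * (H (V p.1 p.2) * Θ p.2 ^ 2) +
          η p.1 * dχ p.1 * (H (V p.1 p.2) * Θ p.2 ^ 2)) := by
      refine integral_congr_ae ?_
      filter_upwards [hdaeW] with p hp
      rw [hp]; ring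
    rw [h1, integral_add hI₁ hI₂]
    have h2 : ∫ p in W, η p.1 * dχ p.1 * (H (V p.1 p.2) * Θ p.2 ^ 2) =
        h⁻¹ * (∫ p in W, (Ioo (t₁ - h) t₁ ×ˢ (univ : Set (EuclideanSpace ℝ (Fin 3)))).indicator
            (fun p => η p.1 * (H (V p.1 p.2) * Θ p.2 ^ 2)) p) -
          h⁻¹ * (∫ p in W, (Ioo t₂ (t₂ + h) ×ˢ (univ : Set (EuclideanSpace ℝ (Fin 3)))).indicator
            (fun p => η p.1 * (H (V p.1 p.2) * Θ p.2 ^ 2)) p) := by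
      rw [← integral_const_mul, ← integral_const_mul, ← integral_sub
        ((hF.indicator (hmI _ measurableSet_Ioo)).const_mul _)
        ((hF.indicator (hmI _ measurableSet_Ioo)).const_mul _)]
      refine integral_congr_ae (Eventually.of_forall fun p => ?_)
      simp only
      rw [← hind, ← hind, hdχ]
      ring
    rw [h2, hslab _ measurableSet_Ioo (fun t ht => ⟨ht₁.trans ht.1, by linarith [ht.2]⟩),
      hslab _ measurableSet_Ioo (fun t ht => ⟨by linarith [ht.1], ht.2.trans ht₂⟩)]
    ring
  rw [hD] at hA
  linarith

end Summit.NavierStokesRegularity.NavierStokesRegularity.Theorems.AveragedConeLiouville.NUPositivity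

end
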